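import Mathlib
import Summits.Ventures.PercRepro2.Defs
import Summits.Ventures.PercRepro2.Harris
import Summits.Ventures.PercRepro2.CoinDefs
import Summits.Ventures.PercRepro2.CoinStarDefs
import Summits.Ventures.PercRepro2.CoinLsmCoreDefs
import Summits.Ventures.PercRepro2.CoinLsmCoreU
import Summits.Ventures.PercRepro2.CoinCoreGate
import Summits.Ventures.PercRepro2.CoinOrTailKDefs
import Summits.Ventures.PercRepro2.CoinOrTailKSums
import Summits.Ventures.PercRepro2.CoinOrTailKAlg
import Summits.Ventures.PercRepro2.CoinOrTailKCore
import Summits.Ventures.PercRepro2.CoinOrTailLsmCore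
import Summits.Ventures.PercRepro2.CoinTreeCore
import Summits.Ventures.PercRepro2.CoinKSureGen
import Summits.Ventures.PercRepro2.CoinFourAtomPush
import Summits.Ventures.PercRepro2.CoinChainCover

/-!
# Pendant OR-TOWERS with covering markers — any number of chained OR-vertices
(blind cell PercRepro2, night-2 g17; proofs/NIGHT2-DARC.md §57.11)

An OR-tower over the core `U` is a list of OR-vertices `v₁, …, vₙ`, each an `OrTailK` over `U`
extended by the earlier ones (`OrTower`); the free arc's tail `a` is an OR-vertex over the whole
tower core (`towerCore`).  The level reductions peel the tower from the top (`OrTower.sum_tower`):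
the two laws on `U` are the iterated OR-tail values `towerVal` — nonnegative, decreasing and
log-supermodular by induction — and with the markers covering every entry of every level
(`r = m₁ ∨ r = m₂ ∨ r ∉ U`: an entry is a marker or an earlier tower vertex) the gate equals the
`R`-law on the levels missing both markers: **`darc_of_towerCover`**, by
`fourAtom_functional_nonneg'`.  `darc_of_chainCover` (one vertex) and `darc_of_chain3Cover` (two)
are its instances; ANY coins throughout.
-/

namespace Summit.Ventures.PercRepro2.Coin

open Classical

section Tower

variable {V : Type*} {E : Type*} [Fintype V] [DecidableEq V] [Fintype E] [DecidableEq E]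
  {R : Type*} [Field R] [LinearOrder R] [IsStrictOrderedRing R]
  {arcs : E → Finset (V × V)} {s : V}

/-- A pendant OR-tower over `U`: each listed vertex is an OR-vertex (`OrTailK`) of the core
extended by the earlier vertices. -/
inductive OrTower (arcs : E → Finset (V × V)) (s : V) :
    Finset V → List (Finset V × (V → E) × V) → Prop
  | nil (U : Finset V) : OrTower arcs s U []
  | cons (U ent : Finset V) (c : V → E) (v : V) (rest : List (Finset V × (V → E) × V)) :
      OrTailK arcs s U ent c v → OrTower arcs s (insert v U) rest →
        OrTower arcs s U ((ent, c, v) :: rest)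

/-- The core of a tower: `U` with the tower vertices. -/
def towerCore (U : Finset V) : List (Finset V × (V → E) × V) → Finset V
  | [] => U
  | x :: rest => towerCore (insert x.2.2 U) rest

/-- The iterated OR-tail value of a head `F` through a tower. -/
noncomputable def towerVal (pr : E → R) : List (Finset V × (V → E) × V) → (Finset V → R) →
    Finset V → R
  | [], F => F
  | x :: rest, F => rValK (towerVal pr rest F) pr x.1 x.2.1 x.2.2

omit [Fintype V] [Fintype E] [DecidableEq E] [Field R] [LinearOrder R] [IsStrictOrderedRing R] in
/-- `U` is contained in the tower core. -/
lemma subset_towerCore (U : Finset V) : ∀ L : List (Finset V × (V → E) × V), U ⊆ towerCore U L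
  | [] => Finset.Subset.refl U
  | x :: rest => (Finset.subset_insert _ _).trans (subset_towerCore (insert x.2.2 U) rest)

omit [Fintype V] [Fintype E] [DecidableEq E] [Field R] [LinearOrder R] [IsStrictOrderedRing R] in
/-- The tower vertices are outside `U`. -/
lemma OrTower.vertex_notin {U : Finset V} {L : List (Finset V × (V → E) × V)}
    (hT : OrTower arcs s U L) : ∀ x ∈ L, x.2.2 ∉ U := by
  induction hT with
  | nil U => intro x hx; exact absurd hx (List.not_mem_nil)
  | cons U ent c v rest h _ ih =>
    intro x hx
    rw [List.mem_cons] at hx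
    rcases hx with rfl | hx
    · exact h.a_notin
    · exact fun hxU => ih x hx (Finset.mem_insert_of_mem hxU)

omit [Fintype V] [LinearOrder R] [IsStrictOrderedRing R] in
/-- **The tower reduction**: the sums over the levels of the tower core reduce to sums over the
levels of `U` with the iterated OR-tail value, for any marker invariant under the tower
vertices. -/
lemma OrTower.sum_tower {U : Finset V} {L : List (Finset V × (V → E) × V)}
    (hT : OrTower arcs s U L) (pr : E → R) (F m : Finset V → R)
    (hm : ∀ x ∈ L, ∀ W, m (insert x.2.2 W) = m W) :
    ∑ W ∈ (towerCore U L).powerset, prob pr (coreLevel arcs s (towerCore U L) W) * F W * m W =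
      ∑ W ∈ U.powerset, prob pr (coreLevel arcs s U W) * towerVal pr L F W * m W := by
  induction hT with
  | nil U => rfl
  | cons U ent c v rest h _ ih =>
    have hm' : ∀ x ∈ rest, ∀ W, m (insert x.2.2 W) = m W :=
      fun x hx => hm x (List.mem_cons_of_mem _ hx)
    have step := ih hm'
    simp only [towerCore] at step ⊢
    rw [step, h.sum_gen pr (towerVal pr rest F) m (hm (ent, c, v) (List.mem_cons_self))]
    rfl

omit [Fintype E] [DecidableEq E] in
/-- `towerVal` of a nonnegative, decreasing, log-supermodular head is nonnegative, decreasing and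
log-supermodular, for every tower. -/
lemma towerVal_props (pr : E → R) (hp0 : ∀ e, 0 ≤ pr e) (hp1 : ∀ e, pr e ≤ 1)
    (L : List (Finset V × (V → E) × V)) (F : Finset V → R) (hF0 : ∀ W, 0 ≤ F W)
    (hFlsm : ∀ s t : Finset V, F s * F t ≤ F (s ∩ t) * F (s ∪ t))
    (hFmono : ∀ s t : Finset V, s ⊆ t → F t ≤ F s) :
    (∀ W, 0 ≤ towerVal pr L F W) ∧
    (∀ s t : Finset V, towerVal pr L F s * towerVal pr L F t ≤
      towerVal pr L F (s ∩ t) * towerVal pr L F (s ∪ t)) ∧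
    (∀ s t : Finset V, s ⊆ t → towerVal pr L F t ≤ towerVal pr L F s) := by
  induction L with
  | nil => exact ⟨hF0, hFlsm, hFmono⟩
  | cons x rest ih =>
    obtain ⟨h0, hlsm, hmono⟩ := ih
    refine ⟨fun W => rValK_nonneg hp0 hp1 h0 x.1 x.2.1 x.2.2 W, ?_, ?_⟩
    · intro s t
      exact rValK_mul_le_all (towerVal pr rest F) pr x.1 x.2.1 x.2.2 hp0 hp1 h0 hlsm hmono s t
    · intro s t hst
      exact rValK_antitone hp0 hp1 hmono x.1 x.2.1 x.2.2 hst

omit [Fintype V] [Fintype E] [DecidableEq E] in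
/-- `towerVal` is monotone in the head. -/
lemma towerVal_head_le (pr : E → R) (hp0 : ∀ e, 0 ≤ pr e) (hp1 : ∀ e, pr e ≤ 1)
    (L : List (Finset V × (V → E) × V)) {F F' : Finset V → R} (hle : ∀ W, F W ≤ F' W) :
    ∀ W, towerVal pr L F W ≤ towerVal pr L F' W := by
  induction L with
  | nil => exact hle
  | cons x rest ih => exact fun W => rValK_head_le hp0 hp1 ih x.1 x.2.1 x.2.2 W

omit [Fintype V] [Fintype E] [DecidableEq E] [LinearOrder R] [IsStrictOrderedRing R] in
/-- On a level missing every entry of every tower vertex, `towerVal` is the head value. -/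
lemma towerVal_of_no_entry (pr : E → R) (L : List (Finset V × (V → E) × V)) (F : Finset V → R)
    {W : Finset V} (hW : ∀ x ∈ L, ∀ r ∈ x.1, r ∉ W) : towerVal pr L F W = F W := by
  induction L with
  | nil => rfl
  | cons x rest ih =>
    simp only [towerVal]
    rw [rValK_eq_of_no_entry (towerVal pr rest F) pr x.2.1 x.2.2
      (hW x (List.mem_cons_self))]
    exact ih fun y hy => hW y (List.mem_cons_of_mem _ hy)

end Tower

section TowerCover

variable {V : Type*} {E : Type*} [Fintype V] [DecidableEq V] [Fintype E] [DecidableEq E]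
  {R : Type*} [Field R] [LinearOrder R] [IsStrictOrderedRing R]
  {arcs : E → Finset (V × V)} {s : V} {U : Finset V} {ent : Finset V} {c : V → E} {a w : V}
  {L : List (Finset V × (V → E) × V)}

/-- **THEOREM (row 2′DARC at the top of a pendant OR-TOWER with covering markers).** `L` an
OR-tower over `U` (ANY coins), `a` an OR-vertex of the tower core (ANY coins), the cluster law of
`U` log-supermodular, the markers `m₁, m₂ ∈ U` covering every entry of every level and of `a`
(`r = m₁ ∨ r = m₂ ∨ r ∉ U`), `t, w ∉ insert a (towerCore U L)`, `t, w ≠ s` ⟹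
`DARC pr arcs s {t} m₁ m₂ a w`. -/
theorem darc_of_towerCover (pr : E → R) (hp : IsProbVec pr) (hS : SameEnds arcs)
    (hT : OrTower arcs s U L) (h : OrTailK arcs s (towerCore U L) ent c a)
    {m₁ m₂ : V} (hm₁ : m₁ ∈ U) (hm₂ : m₂ ∈ U)
    (hcovL : ∀ x ∈ L, ∀ r ∈ x.1, r = m₁ ∨ r = m₂ ∨ r ∉ U)
    (hcov : ∀ r ∈ ent, r = m₁ ∨ r = m₂ ∨ r ∉ U)
    (hν : ∀ W W', W ⊆ U → W' ⊆ U →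
      prob pr (coreLevel arcs s U W) * prob pr (coreLevel arcs s U W') ≤
        prob pr (coreLevel arcs s U (W ∩ W')) * prob pr (coreLevel arcs s U (W ∪ W')))
    {t : V} (htC : t ∉ insert a (towerCore U L)) (hts : t ≠ s) (hws : w ≠ s)
    (hwC : w ∉ insert a (towerCore U L)) :
    DARC pr arcs s {t} m₁ m₂ a w := by
  have hC := h.closedInCoreU
  have hUC : U ⊆ towerCore U L := subset_towerCore U L
  have haC' : a ∉ towerCore U L := h.a_notin
  have hm₁a : m₁ ≠ a := fun e => haC' (e ▸ hUC hm₁)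
  have hm₂a : m₂ ≠ a := fun e => haC' (e ▸ hUC hm₂)
  have hvert := hT.vertex_notin
  have hm₁v : ∀ x ∈ L, m₁ ≠ x.2.2 := fun x hx e => hvert x hx (e ▸ hm₁)
  have hm₂v : ∀ x ∈ L, m₂ ≠ x.2.2 := fun x hx e => hvert x hx (e ▸ hm₂)
  have hm₁C : m₁ ∈ insert a (towerCore U L) := Finset.mem_insert_of_mem (hUC hm₁)
  have hm₂C : m₂ ∈ insert a (towerCore U L) := Finset.mem_insert_of_mem (hUC hm₂)
  have haC : a ∈ insert a (towerCore U L) := Finset.mem_insert_self _ _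
  unfold DARC
  rw [hC.phiC_gate_eq pr hS htC hts hm₁C hm₂C haC hws hwC]
  -- the markers
  have hm1 : ∀ W : Finset V, (fun _ : Finset V => (1 : R)) (insert a W) = (fun _ => (1 : R)) W :=
    fun _ => rfl
  have hm1L : ∀ x ∈ L, ∀ W : Finset V,
      (fun _ : Finset V => (1 : R)) (insert x.2.2 W) = (fun _ => (1 : R)) W := fun _ _ _ => rfl
  have hmp : ∀ W : Finset V, (fun W : Finset V => if m₁ ∈ W then (1 : R) else 0) (insert a W) =
      (fun W : Finset V => if m₁ ∈ W then (1 : R) else 0) W := by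
    intro W; simp only [Finset.mem_insert, hm₁a, false_or]
  have hmpL : ∀ x ∈ L, ∀ W : Finset V,
      (fun W : Finset V => if m₁ ∈ W then (1 : R) else 0) (insert x.2.2 W) =
      (fun W : Finset V => if m₁ ∈ W then (1 : R) else 0) W := by
    intro x hx W; simp only [Finset.mem_insert, hm₁v x hx, false_or]
  have hmq : ∀ W : Finset V, (fun W : Finset V => if m₂ ∈ W then (1 : R) else 0) (insert a W) =
      (fun W : Finset V => if m₂ ∈ W then (1 : R) else 0) W := by
    intro W; simp only [Finset.mem_insert, hm₂a, false_or]
  have hmqL : ∀ x ∈ L, ∀ W : Finset V,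
      (fun W : Finset V => if m₂ ∈ W then (1 : R) else 0) (insert x.2.2 W) =
      (fun W : Finset V => if m₂ ∈ W then (1 : R) else 0) W := by
    intro x hx W; simp only [Finset.mem_insert, hm₂v x hx, false_or]
  have hmpq : ∀ W : Finset V,
      (fun W : Finset V => (if m₁ ∈ W then (1 : R) else 0) * (if m₂ ∈ W then (1 : R) else 0))
        (insert a W) =
      (fun W : Finset V => (if m₁ ∈ W then (1 : R) else 0) * (if m₂ ∈ W then (1 : R) else 0)) W := by
    intro W; simp only [Finset.mem_insert, hm₁a, hm₂a, false_or]
  have hmpqL : ∀ x ∈ L, ∀ W : Finset V,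
      (fun W : Finset V => (if m₁ ∈ W then (1 : R) else 0) * (if m₂ ∈ W then (1 : R) else 0))
        (insert x.2.2 W) =
      (fun W : Finset V => (if m₁ ∈ W then (1 : R) else 0) * (if m₂ ∈ W then (1 : R) else 0)) W := by
    intro x hx W; simp only [Finset.mem_insert, hm₁v x hx, hm₂v x hx, false_or]
  -- the level reduction over `a`
  have eΛ := h.sum_R_eq pr t (fun _ => (1 : R)) hm1
  have eFa := h.sum_R_eq pr t (fun W => if m₁ ∈ W then (1 : R) else 0) hmp
  have eFb := h.sum_R_eq pr t (fun W => if m₂ ∈ W then (1 : R) else 0) hmq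
  have eM := h.sum_G_eq (w := w) pr t (fun _ => (1 : R)) hm1
  have eX := h.sum_G_eq (w := w) pr t (fun W => if m₁ ∈ W then (1 : R) else 0) hmp
  have eY := h.sum_G_eq (w := w) pr t (fun W => if m₂ ∈ W then (1 : R) else 0) hmq
  have eXY := h.sum_G_eq (w := w) pr t
    (fun W => (if m₁ ∈ W then (1 : R) else 0) * (if m₂ ∈ W then (1 : R) else 0)) hmpq
  simp only [mul_one] at eΛ eM
  rw [eΛ, eFa, eFb, eM, eX, eY, eXY]
  set A : Finset V → R := fun X => prob pr (coreAvoidEvent arcs s t (insert a (towerCore U L)) X)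
    with hAdef
  obtain ⟨hA0, hAmono, hAlsm⟩ := OrTailU.head_props (U := towerCore U L) (a := a) pr hp hS t
  have hp0 := hp.nonneg
  have hp1 := hp.le_one
  set FR : Finset V → R := rValK A pr ent c a with hFR
  set FG : Finset V → R := gValK A pr ent c a w with hFG
  -- the tower reduction
  have fΛ := hT.sum_tower pr FR (fun _ => (1 : R)) hm1L
  have fFa := hT.sum_tower pr FR (fun W => if m₁ ∈ W then (1 : R) else 0) hmpL
  have fFb := hT.sum_tower pr FR (fun W => if m₂ ∈ W then (1 : R) else 0) hmqL
  have fM := hT.sum_tower pr FG (fun _ => (1 : R)) hm1L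
  have fX := hT.sum_tower pr FG (fun W => if m₁ ∈ W then (1 : R) else 0) hmpL
  have fY := hT.sum_tower pr FG (fun W => if m₂ ∈ W then (1 : R) else 0) hmqL
  have fXY := hT.sum_tower pr FG
    (fun W => (if m₁ ∈ W then (1 : R) else 0) * (if m₂ ∈ W then (1 : R) else 0)) hmpqL
  simp only [mul_one] at fΛ fM
  rw [fΛ, fFa, fFb, fM, fX, fY, fXY]
  -- the two laws on the core
  have hFR0 : ∀ W, 0 ≤ FR W := fun W => rValK_nonneg hp0 hp1 hA0 ent c a W
  have hFG0 : ∀ W, 0 ≤ FG W := fun W => gValK_nonneg hp0 hp1 hA0 ent c a w W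
  have hFRlsm : ∀ s t : Finset V, FR s * FR t ≤ FR (s ∩ t) * FR (s ∪ t) :=
    fun s t => rValK_mul_le_all A pr ent c a hp0 hp1 hA0 hAlsm hAmono s t
  have hFGlsm : ∀ s t : Finset V, FG s * FG t ≤ FG (s ∩ t) * FG (s ∪ t) :=
    fun s t => gValK_mul_le_all A pr ent c a w hp0 hp1 hA0 hAlsm hAmono s t
  have hFRmono : ∀ s t : Finset V, s ⊆ t → FR t ≤ FR s :=
    fun s t hst => rValK_antitone hp0 hp1 hAmono ent c a hst
  have hFGmono : ∀ s t : Finset V, s ⊆ t → FG t ≤ FG s :=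
    fun s t hst => gValK_antitone hp0 hp1 hAmono ent c a w hst
  have hFGle : ∀ W, FG W ≤ FR W := fun W => gValK_le_rValK hp0 hp1 hAmono ent c a w W
  obtain ⟨hTR0, hTRlsm, _⟩ := towerVal_props pr hp0 hp1 L FR hFR0 hFRlsm hFRmono
  obtain ⟨hTG0, hTGlsm, _⟩ := towerVal_props pr hp0 hp1 L FG hFG0 hFGlsm hFGmono
  set ν : Finset V → R := fun W => prob pr (coreLevel arcs s U W) with hνdef
  have hν0 : ∀ W, 0 ≤ ν W := fun W => prob_nonneg hp _
  set G : Finset V → R := fun W => ν W * towerVal pr L FR W with hGdef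
  set G' : Finset V → R := fun W => ν W * towerVal pr L FG W with hG'def
  have hG0 : ∀ W, 0 ≤ G W := fun W => mul_nonneg (hν0 W) (hTR0 W)
  have hG'0 : ∀ W, 0 ≤ G' W := fun W => mul_nonneg (hν0 W) (hTG0 W)
  have wLL : ∀ s ⊆ U, ∀ t ⊆ U, G s * G t ≤ G (s ∩ t) * G (s ∪ t) := by
    intro s hs t ht
    simp only [hGdef]
    calc ν s * towerVal pr L FR s * (ν t * towerVal pr L FR t)
        = (ν s * ν t) * (towerVal pr L FR s * towerVal pr L FR t) := by ring
      _ ≤ (ν (s ∩ t) * ν (s ∪ t)) * (towerVal pr L FR (s ∩ t) * towerVal pr L FR (s ∪ t)) :=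
          mul_le_mul (hν s t hs ht) (hTRlsm s t) (mul_nonneg (hTR0 _) (hTR0 _))
            (mul_nonneg (hν0 _) (hν0 _))
      _ = _ := by ring
  have wMM : ∀ s ⊆ U, ∀ t ⊆ U, G' s * G' t ≤ G' (s ∩ t) * G' (s ∪ t) := by
    intro s hs t ht
    simp only [hG'def]
    calc ν s * towerVal pr L FG s * (ν t * towerVal pr L FG t)
        = (ν s * ν t) * (towerVal pr L FG s * towerVal pr L FG t) := by ring
      _ ≤ (ν (s ∩ t) * ν (s ∪ t)) * (towerVal pr L FG (s ∩ t) * towerVal pr L FG (s ∪ t)) :=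
          mul_le_mul (hν s t hs ht) (hTGlsm s t) (mul_nonneg (hTG0 _) (hTG0 _))
            (mul_nonneg (hν0 _) (hν0 _))
      _ = _ := by ring
  have hle : ∀ W ∈ U.powerset, G' W ≤ G W := fun W _ =>
    mul_le_mul_of_nonneg_left (towerVal_head_le pr hp0 hp1 L hFGle W) (hν0 W)
  have h00 : ∀ W ∈ U.powerset, m₁ ∉ W → m₂ ∉ W → G' W = G W := by
    intro W hW h1 h2
    have hWU : W ⊆ U := Finset.mem_powerset.1 hW
    have hnoL : ∀ x ∈ L, ∀ r ∈ x.1, r ∉ W := by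
      intro x hx r hr hrW
      rcases hcovL x hx r hr with rfl | rfl | hrU
      · exact h1 hrW
      · exact h2 hrW
      · exact hrU (hWU hrW)
    have hno : ∀ r ∈ ent, r ∉ W := by
      intro r hr hrW
      rcases hcov r hr with rfl | rfl | hrU
      · exact h1 hrW
      · exact h2 hrW
      · exact hrU (hWU hrW)
    simp only [hGdef, hG'def]
    rw [towerVal_of_no_entry pr L FR hnoL, towerVal_of_no_entry pr L FG hnoL]
    simp only [hFR, hFG]
    rw [gValK_eq_rValK_of_no_entry A pr c a w hno]
  exact fourAtom_functional_nonneg' U G G' m₁ m₂ hG0 hG'0 wLL wMM hle h00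

end TowerCover

end Summit.Ventures.PercRepro2.Coin
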